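import Summits.BirchSwinnertonDyer.Rank1Residual.Additive.LocIrrThreeCriteria
import Literature.NumberTheory.EllipticCurves.QuadraticTwist
import HarnessLib

/-!
# Local irreducibility of `E[3]` at `3` READ OFF `(v₃(c₄), v₃(c₆))`: the valuation criterion
# (theorem-candidate L-O56-sel, nothing asserted), its model / twist invariance (PROVED), and the
# SELECTOR IDENTITY on the tame potentially supersingular cell O5b (theorem-candidate): o5-r1's
# "CM-near" bit `v₃(j − 1728) ≥ 7` IS the Fouquet–Wan bit `LocIrr W 3`
# (cell `b2b-bsdres`, lane CLASS-CLOSURE, seat cc-typer-5 GEN 3 = O5/O6 typer of record; asks A-O56-U1 of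
#  o6-r1 GEN 3 and (c) of `cells/o5o6/TARGETS.md` §O6 (G3-10); EVIDENCE-labelled; 0 `@[conjecture]` nodes,
#  0 named Literature facts)

HONEST FRAMING (cell `b2b-bsdres`, run/shared/lean/b2b/bsd-rank1-residual/, verbatim in every file):
the goal of the cell is to DELETE the COMBINATION-SHAPED residual classes of the Birch–Swinnerton-Dyer
formula for ALL analytic-rank `≤ 1` elliptic curves over `ℚ` — "full BSD formula for every rank `≤ 1`
curve in class `C`" assembled STRICTLY from published theorems — so that the rank-`≤ 1` remainder
becomes exactly the CONSTRUCTION-SHAPED classes, which are TYPED (missing-input `Prop`s), NOT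
attempted. This is not "finishing BSD". Lane CLASS-CLOSURE: research routes; no claim beyond the
stated classes; census output is EVIDENCE, never a Literature fact; nothing is booked; no mark of
`RESIDUAL-MAP.md` moves. This file: one census-decidable predicate with PROVED invariance lemmas, two
TARGET `Prop`s (theorem-candidates, nothing asserted) and kernel corollaries.

## Why (o6-r1 GEN 3, `cells/o5o6/TARGETS.md` §O6 (G3-10), kit j124555, INBOX 2026-08-21T07:13Z/07:26Z)

`LocIrr W 3` (`Additive/FouquetWanLocus.lean`: `ρ̄_{E,3}|G_{ℚ₃}` irreducible — the (Lgl) hypothesis of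
Fouquet–Wan's announced main-conjecture theorem, exact at `p = 3`) turned out to be THE selector of the
Mazur–Tate growth dichotomy at an additive potentially supersingular `3` (signed Kurihara–Pollack
growth iff `LocIrr`, unsigned level law iff not; `Additive/MazurTateGrowthDichotomyThree.lean`), and on
the census it is decided by the minimal model's `c`-invariants: on all 36 323 O5b rows (Kodaira III /
III*; X4 31 044 + X3 5 279) and all 296 O6-dicyclic rows (`N ≤ 5 000`) `LocIrr(3) ⟺ 2·v₃(c₆) >
3·v₃(c₄)`, 0 exceptions (PARI `polrootspadic` on `ψ₃`; `HOME/b2b-bsdres-o6-r1/gen3/compute/j124555/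
o5_locirr.txt` sha16 d6b032a0d8344a17, `gen3/tower/d1h_score.txt` 8313c50ab7d3a34b), and on the same
O5b rows o5-r1's T9 selector `v₃(j − 1728) ≥ 7` is the same bit (near = LocIrr = 11 310, generic =
reducible = 25 013, 0 exceptions).

## What is typed (typer's reading of the local algebra — a THEOREM-CANDIDATE with its proof route, not
## a census fit; the census is its sanity check)

For `E/ℚ₃` with invariants `c₄, c₆` (any model) let `a = v₃(c₄)`, `b = v₃(c₆)`. On the `ℚ₃`-model
`y² = x³ − 27c₄x − 54c₆` the `3`-division polynomial is `ψ₃ = 3x⁴ + 6Ax² + 12Bx − A²` (`A = −27c₄`,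
`B = −54c₆`), with `3`-adic Newton points `(4,1), (2, a+4), (1, b+4), (0, 2a+6)`. A `G_{ℚ₃}`-stable line
in `E[3]` is the same as a root of `ψ₃` in `ℚ₃` (the `x`-coordinate of `±P`). The chord from `(0, 2a+6)`
to `(4,1)` has slope `−(2a+5)/4`; the point `(2, a+4)` always lies above it and `(1, b+4)` lies on or
above it iff `4b ≥ 6a + 3` iff **`2b ≥ 3a + 2`**. In that case all four roots have valuation `(2a+5)/4
∉ ℤ`, so none is in `ℚ₃`: IRREDUCIBLE; otherwise the first segment `(0,2a+6)–(1,b+4)` has length one, a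
linear factor over `ℚ₃`: REDUCIBLE. Degenerate cases: `c₄ = 0` (`j = 0`): `ψ₃ = 3x(x³ + 4B)`, root `0`,
REDUCIBLE; `c₆ = 0` (`j = 1728`): single segment, IRREDUCIBLE. Both sides are invariant under
`(c₄, c₆) ↦ (u⁴c₄, u⁶c₆)` and under quadratic twists `(d²c₄, d³c₆)` (PROVED below), as they must be.
Hence the target **L-O56-sel**: `LocIrr W 3 ↔ LocIrrCriterionThree W` for EVERY elliptic curve over
`ℚ`, where `LocIrrCriterionThree W := c₄ ≠ 0 ∧ (c₆ = 0 ∨ 3·v₃(c₄) + 2 ≤ 2·v₃(c₆))`. o6-r1's census form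
`2·v₃(c₆) > 3·v₃(c₄)` differs from it only when `2b = 3a + 1`, i.e. `(a,b) ∈ {(1,2), (3,5), (5,8), …}`
— for minimal models at `3` exactly the CYCLIC wild rows IV `(3,5,6)` and II* `(5,8,12)` of the
Halberstadt–Rizzo table (`(1,2,0)` is not the invariant pair of an integral model, Kraus), where the
sharp form says "reducible", as o6-r1 observed ("`(3,5)` yet reducible"; `LocIrr` = 0 / 5 161 cyclic
rows) — so on III / III* / dicyclic rows the two forms agree (`locIrrCriterionThree_iff_censusTest_of_ne`).
Sanity checks of the sharp form against theory: good ordinary `(0,0,0)` reducible ✓, good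
supersingular (`a = 1, b ≥ 3, v(Δ) = 0`) irreducible ✓, multiplicative / `I_n^*` (`a = 0` / `(2,3,≥6)`)
reducible ✓, `I₀*` `(3, ≥6, 6)` (O5a = twist of good supersingular) irreducible ✓ (census 9 744/9 744).
Instrumentation (this seat, kit j125222, PARI `polrootspadic` vs the criterion on a `(v₃c₄, v₃c₆)` grid
`a ≤ 9, b ≤ 14` × 16² unit parts and an `a`-invariant box): appended to `class-closure/O6/TYPED.md` §7
when it reports. Typed as a TARGET (Mathlib has no Newton-polygon factorisation over `ℚ_p` and the tree
no "`LocIrr ⟺ ψ₃` rootless" lemma); a prover's item.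

**Selector identity on O5b** (target `SelectorIdentityTameThree`; consequence of L-O56-sel + Table II,
derivation: `j − 1728 = c₆²/Δ`, so `v₃(j − 1728) = 2b − v₃(Δ)`; III rows are `(≥2,3,3)` [both sides
false: `v₃(j−1728) = 3`] or `(2, ≥5, 3)` [both true: `≥ 7`]; III* rows `(≥4,6,9)` [false, `= 3`] or
`(4, ≥8, 9)` [true, `≥ 7`] — which also explains o5-r1's census gap "`v₃(j − 1728) ∈ {3} ∪ [7, 21]`,
never `4, 5, 6`": `b = 4` at `v(Δ) = 3` is the WILD type-II row `(2,4,3)`, `b = 7` at `v(Δ) = 9` the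
wild IV* row `(4,7,9)`): for `W ∈ O5b` (Kodaira III/III* at `3`) with `j ≠ 1728`,
`LocIrr W 3 ↔ 7 ≤ v₃(j − 1728)`. EVIDENCE 36 323 / 0 (j124555). It is the bridge between o5-r1's T9
(`O5/O5GrowthLaws.lean`, selector `v₃(j − 1728) ≥ 7`, untouched) and the `LocIrr` form of the
dichotomy (`Additive/MazurTateGrowthDichotomyThree.lean`).

## KERNEL STATUS (DOC-ONLY notes; every declaration and statement below is byte-identical to p255094)

* 2026-08-21 (GEN 8 note): L-O56-sel `LocIrrThreeIffCriterion` is PROVED — `locIrrThreeIffCriterion_holds`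
  (harvest-2 GEN 42 E89, `Additive/LocIrrValuationCriterionThreeProofs.lean` p292696).
* 2026-08-21 (GEN 9 note): `SelectorIdentityTameThree` is DERIVED modulo ONE cited named fact, the `v(N)`
  column of Rizzo's Table II at `3` (`WeierstrassCurve.conductorExponent_eq_tableConductorExponentThree`, NOT
  discharged) — `Additive.selectorIdentityTameThree_of_tableII` (cross-cell pool hand x11b3-p7 GEN 7,
  `Additive/SelectorIdentityTameThreeProofs.lean` p297328, on harvest-2 E89 §4); the growth-dichotomy bridges
  with their `hsel` binder fed by it: `Additive/MazurTateGrowthDichotomyThreeTableII.lean` (this seat, GEN 9).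
  Census 36 323 / 0 stays EVIDENCE; nothing booked; no mark.
* 2026-08-21 (GEN 9 note 2): `SelectorIdentityTameThree` is **PROVED, unconditionally —
  `Additive.selectorIdentityTameThree_holds : SelectorIdentityTameThree`** (x11b3-p7 GEN 7,
  `Additive/SelectorIdentityTameThreeProofs.lean` p297328 + `Additive/SelectorIdentityTameThreeHolds.lean` p298753:
  the Table II hypothesis of note 1 is RETIRED — Tate's algorithm Steps 4 / 9 normal forms at `3`
  (`exists_variableChange_b_of_kodairaSymbolAt_eq_III` / `_eq_IIIstar`) give the BRACKET LEMMA
  `valued_j_sub_eq_or_le_of_b_shape` (`ord c₆ ∈ {m} ∪ [m+2, ∞)`, never `4` on III, never `7` on III*), whence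
  III / III* ⟹ `v₃(j − 1728) ∈ {3} ∪ [7, ∞)` (`padicValRat_j_sub_eq_three_or_seven_le_of_kodairaSymbolAt_III_or_IIIstar`,
  table-free), with (t′) ⟺ III/III* (`subTprime_three_iff_kodairaSymbolAt_III_or_IIIstar`), `ord Δ_min = m + 1` and
  L-O56-sel; per curve `locIrr_three_iff_seven_le_of_subTprime (hadd) (hT) (hj)`; no named fact enters). BOTH targets of this file are now
  THEOREMS; the bridges of `Additive/MazurTateGrowthDichotomyThree.lean` take `hsel := selectorIdentityTameThree_holds`
  (composed in `MazurTateGrowthDichotomyThreeTableII.lean` §2). Census stays EVIDENCE; nothing booked; no mark.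

References: O. Fouquet, X. Wan, arXiv:2107.13726 Thm 5.1 (hypothesis "ρ̄_f|G_{ℚ_p} irreducible")
[FouquetWan2021]; O. Rizzo, Compositio Math. 136 (2003) Table II (`p = 3`) [Rizzo2003]; A. Kraus,
Manuscripta Math. 69 (1990) [Kraus1990]; J. Neukirch, *Algebraic Number Theory* II §6 (Newton polygon)
[folklore]; L. Doyon, A. Lei, arXiv:2103.06154 §6 (the two growth patterns among potentially
supersingular curves, "we will look for a theoretic explanation on how these two distinct cases arise")
[DoyonLei2021].
-/

set_option autoImplicit false

noncomputable section

open scoped Classical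

open WeierstrassCurve Literature.NumberTheory.EllipticCurves
  Literature.NumberTheory.EllipticCurves.Rank1Residual
  Literature.NumberTheory.EllipticCurves.Rank1Residual.Typed

namespace Summit.BirchSwinnertonDyer.Rank1Residual.Additive

/-! ## §1 The criterion (census-decidable; a predicate of the curve, not of the model) -/

/-- **The `c₄/c₆` valuation criterion for `LocIrr(3)`** (sharp form, from the Newton polygon of `ψ₃`):
`c₄ ≠ 0 ∧ (c₆ = 0 ∨ 2·v₃(c₆) ≥ 3·v₃(c₄) + 2)` — read "`v₃(0) = +∞`": `j = 1728` passes, `j = 0` fails.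
Census column `two_v6_ge_three_v4_plus_2`. [folklore] -/
def LocIrrCriterionThree (W : WeierstrassCurve ℚ) : Prop :=
  W.c₄ ≠ 0 ∧ (W.c₆ = 0 ∨ 3 * padicValRat 3 W.c₄ + 2 ≤ 2 * padicValRat 3 W.c₆)

/-- **o6-r1's census form** `2·v₃(c₆) > 3·v₃(c₄)` (TARGETS §O6 (G3-10); column `two_v6_gt_three_v4`),
with the same conventions at `c₄ c₆ = 0`. Agrees with the sharp form unless `2·v₃(c₆) = 3·v₃(c₄) + 1`
(cyclic wild rows IV `(3,5,6)`, II* `(5,8,12)`), where only the sharp form is right. [folklore] -/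
def LocIrrCensusTestThree (W : WeierstrassCurve ℚ) : Prop :=
  W.c₄ ≠ 0 ∧ (W.c₆ = 0 ∨ 3 * padicValRat 3 W.c₄ < 2 * padicValRat 3 W.c₆)

/-- The sharp criterion implies the census form. [folklore] -/
theorem LocIrrCriterionThree.censusTest {W : WeierstrassCurve ℚ} (h : LocIrrCriterionThree W) :
    LocIrrCensusTestThree W := by
  refine ⟨h.1, ?_⟩
  rcases h.2 with h0 | hle
  · exact Or.inl h0
  · exact Or.inr (by omega)

/-- Off the line `2·v₃(c₆) = 3·v₃(c₄) + 1` the two forms coincide (all III / III* / dicyclic rows of the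
Halberstadt–Rizzo table at `3`). [folklore] -/
theorem locIrrCriterionThree_iff_censusTest_of_ne {W : WeierstrassCurve ℚ}
    (hne : 2 * padicValRat 3 W.c₆ ≠ 3 * padicValRat 3 W.c₄ + 1) :
    LocIrrCriterionThree W ↔ LocIrrCensusTestThree W := by
  refine ⟨LocIrrCriterionThree.censusTest, fun h ↦ ⟨h.1, ?_⟩⟩
  rcases h.2 with h0 | hlt
  · exact Or.inl h0
  · exact Or.inr (by omega)

/-- `v₃(u^n · x) = n·v₃(u) + v₃(x)` for `u, x ≠ 0` (bookkeeping). [folklore] -/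
private theorem padicValRat_pow_mul {u x : ℚ} (hu : u ≠ 0) (hx : x ≠ 0) (n : ℕ) :
    padicValRat 3 (u ^ n * x) = n * padicValRat 3 u + padicValRat 3 x := by
  rw [padicValRat.mul (pow_ne_zero n hu) hx, padicValRat.pow u]

/-- **Model independence**: the criterion is invariant under every change of Weierstrass model
(`c₄ ↦ u⁻⁴c₄`, `c₆ ↦ u⁻⁶c₆`; `2·6 = 3·4`). [folklore] -/
theorem locIrrCriterionThree_smul_iff (W : WeierstrassCurve ℚ) (C : VariableChange ℚ) :
    LocIrrCriterionThree (C • W) ↔ LocIrrCriterionThree W := by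
  have hu : ((C.u⁻¹ : ℚˣ) : ℚ) ≠ 0 := Units.ne_zero _
  unfold LocIrrCriterionThree
  rw [variableChange_c₄, variableChange_c₆]
  simp only [ne_eq, mul_eq_zero, pow_eq_zero_iff (by norm_num : (4 : ℕ) ≠ 0),
    pow_eq_zero_iff (by norm_num : (6 : ℕ) ≠ 0), hu, false_or]
  by_cases h4 : W.c₄ = 0
  · simp [h4]
  by_cases h6 : W.c₆ = 0
  · simp [h6]
  simp only [h4, h6, not_false_eq_true, true_and, false_or]
  rw [padicValRat_pow_mul hu h4, padicValRat_pow_mul hu h6]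
  push_cast
  constructor <;> intro h <;> linarith

/-- **Twist invariance**: the criterion is invariant under every quadratic twist (`c₄ ↦ d²c₄`,
`c₆ ↦ d³c₆`) — as local (ir)reducibility of `E[3] ⊗ χ` must be; in particular under the `χ₋₃`-twist
that exchanges Kodaira III ↔ III* (o5-r1 T8) and II `(2,4,3)` ↔ IV* `(4,7,9)`. [folklore] -/
theorem locIrrCriterionThree_quadraticTwist_iff (W : WeierstrassCurve ℚ) {d : ℚ} (hd : d ≠ 0) :
    LocIrrCriterionThree (W.quadraticTwist d) ↔ LocIrrCriterionThree W := by
  unfold LocIrrCriterionThree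
  rw [quadraticTwist_c₄, quadraticTwist_c₆]
  simp only [ne_eq, mul_eq_zero, pow_eq_zero_iff (by norm_num : (2 : ℕ) ≠ 0),
    pow_eq_zero_iff (by norm_num : (3 : ℕ) ≠ 0), hd, false_or]
  by_cases h4 : W.c₄ = 0
  · simp [h4]
  by_cases h6 : W.c₆ = 0
  · simp [h6]
  simp only [h4, h6, not_false_eq_true, true_and, false_or]
  rw [padicValRat_pow_mul hd h4, padicValRat_pow_mul hd h6]
  push_cast
  constructor <;> intro h <;> linarith

/-- `v₃(1728) = 3`. [folklore] -/
private theorem padicValRat_three_1728 : padicValRat 3 (1728 : ℚ) = 3 := by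
  have h3 : padicValRat 3 (3 : ℚ) = 1 := by
    have := padicValRat.self (p := 3) (by norm_num)
    simpa using this
  have h64 : padicValRat 3 (64 : ℚ) = 0 := by
    have : (64 : ℚ) = ((64 : ℕ) : ℚ) := by norm_num
    rw [this, padicValRat.of_nat]
    simp only [Nat.cast_eq_zero]
    exact padicValNat.eq_zero_of_not_dvd (by norm_num)
  have h : (1728 : ℚ) = (3 : ℚ) ^ 3 * 64 := by norm_num
  rw [h, padicValRat.mul (by norm_num) (by norm_num), padicValRat.pow (3 : ℚ), h3, h64]
  norm_num

/-- **Under the criterion the discriminant valuation is `3·(v₃(c₄) − 1)`** (the `c₄³` term dominates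
in `1728Δ = c₄³ − c₆²`): in particular `3 ∣ v₃(Δ)` — the first conjunct of gen 2's necessary condition
`MinimalDiscIsCubeUnramifiedThree` (L-O6-irr) is a consequence of the criterion. [folklore] -/
theorem padicValRat_Δ_of_locIrrCriterionThree (W : WeierstrassCurve ℚ) [W.IsElliptic]
    (h : LocIrrCriterionThree W) : padicValRat 3 W.Δ = 3 * padicValRat 3 W.c₄ - 3 := by
  obtain ⟨h4, h⟩ := h
  have hΔ : W.Δ ≠ 0 := W.isUnit_Δ.ne_zero
  have hrel : W.Δ = (W.c₄ ^ 3 - W.c₆ ^ 2) / 1728 := by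
    have := W.c_relation
    field_simp
    linarith
  have hdiff : W.c₄ ^ 3 - W.c₆ ^ 2 ≠ 0 := by
    intro h0; apply hΔ; rw [hrel, h0, zero_div]
  have hc4v : padicValRat 3 (W.c₄ ^ 3) = 3 * padicValRat 3 W.c₄ := by
    rw [padicValRat.pow]; push_cast; ring
  have hmain : padicValRat 3 (W.c₄ ^ 3 - W.c₆ ^ 2) = 3 * padicValRat 3 W.c₄ := by
    rcases h with h6 | hle
    · rw [h6, zero_pow two_ne_zero, sub_zero, hc4v]
    · by_cases h6 : W.c₆ = 0
      · rw [h6, zero_pow two_ne_zero, sub_zero, hc4v]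
      have hc6v : padicValRat 3 (-(W.c₆ ^ 2)) = 2 * padicValRat 3 W.c₆ := by
        rw [padicValRat.neg, padicValRat.pow]; push_cast; ring
      have hlt : padicValRat 3 (W.c₄ ^ 3) < padicValRat 3 (-(W.c₆ ^ 2)) := by
        rw [hc4v, hc6v]; omega
      rw [sub_eq_add_neg, padicValRat.add_eq_of_lt (by rwa [← sub_eq_add_neg]) (pow_ne_zero 3 h4)
        (neg_ne_zero.mpr (pow_ne_zero 2 h6)) hlt, hc4v]
  rw [hrel, padicValRat.div hdiff (by norm_num), hmain, padicValRat_three_1728]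

/-- Hence `3 ∣ v₃(Δ_min)` for a globally minimal `W` satisfying the criterion — the first conjunct of
`MinimalDiscIsCubeUnramifiedThree W` (gen 2, `Additive/LocIrrThreeCriteria.lean`). [folklore] -/
theorem three_dvd_padicValInt_minimalDiscriminantInt_of_locIrrCriterionThree (W : WeierstrassCurve ℚ)
    [W.IsElliptic] [W.IsGloballyMinimal] (h : LocIrrCriterionThree W) :
    (3 : ℤ) ∣ (padicValInt 3 W.minimalDiscriminantInt : ℤ) := by
  have hv := padicValRat_Δ_of_locIrrCriterionThree W h
  rw [← cast_minimalDiscriminantInt, padicValRat.of_int] at hv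
  exact ⟨padicValRat 3 W.c₄ - 1, by rw [hv]; ring⟩

/-! ## §2 The two targets (theorem-candidates; nothing asserted) -/

/-- **L-O56-sel (TARGET, theorem-candidate; EVIDENCE-labelled; nothing asserted).** For every elliptic
curve `E/ℚ`: `E[3]` is an irreducible `G_{ℚ₃}`-module (`LocIrr W 3`, the Fouquet–Wan (Lgl) bit at
`p = 3`) iff `LocIrrCriterionThree W` (`c₄ ≠ 0 ∧ (c₆ = 0 ∨ 2·v₃(c₆) ≥ 3·v₃(c₄) + 2)`). ROUTE (module
docstring): `G_{ℚ₃}`-stable lines of `E[3]` ↔ roots of `ψ₃` in `ℚ₃`; Newton polygon of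
`ψ₃ = 3x⁴ + 6Ax² + 12Bx − A²` on `y² = x³ + Ax + B`, `A = −27c₄`, `B = −54c₆`: single segment of slope
`−(2v₃(c₄)+5)/4` iff the criterion holds (no root of integral valuation), else a length-one first
segment (a root in `ℚ₃`). Missing in Mathlib/the tree: Newton-polygon factorisation over `ℚ_p`, the
`ψ₃`-root ↔ stable-line dictionary. EVIDENCE (census, `polrootspadic` on `ψ₃`): all 36 323 O5b rows +
9 744 O5a rows (kit j124555, o6-r1 GEN 3) and 296 O6-dicyclic rows `N ≤ 5 000` (D1 + D1H), where the
criterion coincides with o6-r1's `2·v₃(c₆) > 3·v₃(c₄)`: 0 exceptions; cyclic wild rows: `LocIrr` =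
0 / 5 161 as the sharp form predicts; kit j125222 (this seat; grid over `(v₃c₄, v₃c₆)` and an
`a`-invariant box) — result appended to `class-closure/O6/TYPED.md` §7. Falsifier: one curve over `ℚ`
(any reduction type at `3`) on which `polrootspadic(ψ₃, 3)` and the criterion disagree.
**PROVED 2026-08-21 (kernel): `Additive.locIrrThreeIffCriterion_holds : LocIrrThreeIffCriterion`** (harvest-2
GEN 42 E89, `Additive/LocIrrValuationCriterionThreeProofs.lean` p292696: model independence of both sides ⟹ short
model ⟹ `Ψ₃`-root dictionary `ModThreeReducibleIffPsi3Root.lean` p290642 + Newton polygon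
`PsiThreeNewtonPolygon.lean` p291813 — exactly the route of this docstring); the §3 corollaries are UNCONDITIONAL
there under primed names (`not_locIrr_three_of_c₄_eq_zero'`, `locIrr_three_of_c₆_eq_zero'`, `locIrr_three_of_le'`,
`not_locIrr_three_of_lt'`, `locIrr_three_iff_of_twist'`, `three_dvd_padicValInt_minimalDiscriminantInt_of_locIrr'`).
L-O56-sel is CLOSED; `SelectorIdentityTameThree` below stays a TARGET (needs Table II's III/III* rows as tree theorems).
UPDATE 2026-08-21 (GEN 9 note): `SelectorIdentityTameThree` is now DERIVED modulo the cited Table II conductor column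
(`Additive.selectorIdentityTameThree_of_tableII`, p297328) — see its docstring.
[cite: FouquetWan2021, Thm. 5.1 (hypothesis ρ̄_f|G_{ℚ_p} irreducible)] -/
def LocIrrThreeIffCriterion : Prop :=
  ∀ (W : WeierstrassCurve ℚ) [W.IsElliptic] [W.IsGloballyMinimal], LocIrr W 3 ↔ LocIrrCriterionThree W

/-- **SELECTOR IDENTITY on O5b (TARGET, theorem-candidate ⇐ L-O56-sel + Halberstadt–Rizzo Table II;
EVIDENCE 36 323 / 0; nothing asserted).** For `W` in the tame potentially supersingular cell O5b at `3`
(`ClassO5 W 3 ∧ SubTprime W 3`: Kodaira III or III*, `e = 4`) with `j(W) ≠ 1728`: `E[3]|G_{ℚ₃}` is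
irreducible iff `v₃(j − 1728) ≥ 7` — o5-r1's T9 selector ("CM-near", `O5/O5GrowthLaws.lean`) IS the
local-irreducibility bit (o6-r1 GEN 3 (G3-10): near = LocIrr = 11 310, generic = reducible = 25 013 on
the 36 323 III/III* rows of the S-b census, X3 and X4, 0 exceptions; kit j124555
`o5_locirr.txt` d6b032a0d8344a17). Derivation from L-O56-sel: `j − 1728 = c₆²/Δ`, III rows
`(v₃c₄, v₃c₆, v₃Δ) = (≥2,3,3)` (both sides false, `v₃(j−1728) = 3`) or `(2,≥5,3)` (both true, `≥ 7`),
III* rows `(≥4,6,9)` (false, `3`) or `(4,≥8,9)` (true, `≥ 7`). At `j = 1728` (`c₆ = 0`, CM by `ℤ[i]`)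
`LocIrr` holds but `v₃(0)` is junk `0` in Lean — hence the hypothesis; `j = 0` needs none (both sides
false: `c₄ = 0`, `v₃(−1728) = 3`).
**DERIVED 2026-08-21 (kernel), modulo ONE cited named fact:
`Additive.selectorIdentityTameThree_of_tableII (h3 : ∀ W, W.conductorExponent_eq_tableConductorExponentThree) :
SelectorIdentityTameThree`** (cross-cell pool hand x11b3-p7 GEN 7, `Additive/SelectorIdentityTameThreeProofs.lean`
p297328, on harvest-2 E89 §4): L-O56-sel (`locIrrThreeIffCriterion_holds`) + the six `v(N) = 2` rows of the
transcribed `Rizzo.tableII` (`rizzo_tableII_condExp_eq_two`; `rows_of_condExpOfInvariants_eq_two` — shift-invariant,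
no minimality used) + `v₃(j − 1728) = 2·v₃(c₆) − v₃(Δ)`; the WILD rows II `(2,4,3)` / IV* `(4,7,9)` (criterion true,
`v₃(j − 1728) = 5`) are excluded by `v(N) = 2`. Per curve, `locIrr_three_iff_seven_le_of_subTprime_of_tableII W h3 hT hj`
needs only Table II FOR THAT `W`, `SubTprime W 3` and `j ≠ 1728` (`ClassO5` unused), and o5-r1's census gap is the
theorem `padicValRat_j_sub_eq_three_or_seven_le_of_subTprime_of_tableII` (`v₃(j − 1728) ∈ {3} ∪ [7, ∞)` on (t′)).
STATUS: TARGET ↦ DERIVED modulo the Table II conductor column (the named fact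
`WeierstrassCurve.conductorExponent_eq_tableConductorExponentThree` — Tate's algorithm at `3` versus the printed table —
cited, NOT discharged); an unconditional route (Tate normal forms: `v₃(c₆) ≠ 4` on III, `≠ 7` on III*) is deferred by
its author; this statement is byte-identical; EVIDENCE 36 323 / 0 stays EVIDENCE; nothing booked; no mark. Consumers:
the `hsel` binder of `Additive/MazurTateGrowthDichotomyThree.lean` is fed by `selectorIdentityTameThree_of_tableII h3`,
composed (also per curve) in `Additive/MazurTateGrowthDichotomyThreeTableII.lean` (this seat, GEN 9).
**PROVED 2026-08-21 (kernel), UNCONDITIONALLY: `Additive.selectorIdentityTameThree_holds : SelectorIdentityTameThree`**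
(x11b3-p7 GEN 7, `Additive/SelectorIdentityTameThreeHolds.lean` p298753 — the "unconditional route" of the previous
sentence, no longer deferred: Tate Steps 4 / 9 bracket lemma + (t′) ⟺ III/III* + L-O56-sel; the Table II binder RETIRED
for this identity). FINAL STATUS: THEOREM (statement byte-identical; census stays EVIDENCE; nothing booked; no mark);
consumers feed `hsel := selectorIdentityTameThree_holds` (`MazurTateGrowthDichotomyThreeTableII.lean` §2).
[cite: Rizzo2003, Table II (rows III, III*)] -/
def SelectorIdentityTameThree : Prop :=
  ∀ (W : WeierstrassCurve ℚ) [W.IsElliptic] [W.IsGloballyMinimal],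
    ClassO5 W 3 → SubTprime W 3 → W.j ≠ 1728 → (LocIrr W 3 ↔ 7 ≤ padicValRat 3 (W.j - 1728))

/-! ## §3 Kernel corollaries for consumers (granted L-O56-sel; nothing asserted beyond it) -/

section Corollaries

variable (W : WeierstrassCurve ℚ) [W.IsElliptic] [W.IsGloballyMinimal]

/-- `j = 0` (`c₄ = 0`) ⇒ locally reducible at `3`, granted L-O56-sel. [folklore] -/
theorem not_locIrr_three_of_c₄_eq_zero (h : LocIrrThreeIffCriterion) (hc : W.c₄ = 0) :
    ¬ LocIrr W 3 := fun hL ↦ ((h W).mp hL).1 hc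

/-- `j = 1728` (`c₆ = 0`, `c₄ ≠ 0`) ⇒ locally irreducible at `3`, granted L-O56-sel. [folklore] -/
theorem locIrr_three_of_c₆_eq_zero (h : LocIrrThreeIffCriterion) (hc4 : W.c₄ ≠ 0) (hc6 : W.c₆ = 0) :
    LocIrr W 3 := (h W).mpr ⟨hc4, Or.inl hc6⟩

/-- The valuation form: `c₄ ≠ 0 ∧ 2·v₃(c₆) ≥ 3·v₃(c₄) + 2 ⇒ LocIrr W 3`, granted L-O56-sel. [folklore] -/
theorem locIrr_three_of_le (h : LocIrrThreeIffCriterion) (hc4 : W.c₄ ≠ 0)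
    (hle : 3 * padicValRat 3 W.c₄ + 2 ≤ 2 * padicValRat 3 W.c₆) : LocIrr W 3 :=
  (h W).mpr ⟨hc4, Or.inr hle⟩

/-- The reducible side: `c₆ ≠ 0 ∧ 2·v₃(c₆) ≤ 3·v₃(c₄) + 1 ⇒ ¬ LocIrr W 3`, granted L-O56-sel —
e.g. every cyclic wild row (II `(2,3,4)`, IV `(3,5,6)`, IV* `(4,6,10)`, II* `(5,8,12)`), every `(M)` /
multiplicative / good ordinary row, and the generic III `(≥2,3,3)` / III* `(≥4,6,9)` rows. [folklore] -/
theorem not_locIrr_three_of_lt (h : LocIrrThreeIffCriterion) (hc6 : W.c₆ ≠ 0)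
    (hlt : 2 * padicValRat 3 W.c₆ ≤ 3 * padicValRat 3 W.c₄ + 1) : ¬ LocIrr W 3 := by
  intro hL
  rcases ((h W).mp hL).2 with h0 | hle
  · exact hc6 h0
  · omega

/-- `LocIrr(3)` is quadratic-twist invariant, granted L-O56-sel (for twists presented by globally
minimal models `Wd ≅ W ⊗ χ_d`): consistency with the O5a dictionary (`SubGss ↔` good supersingular
twist, all `LocIrr`) and with T8. [folklore] -/
theorem locIrr_three_iff_of_twist (h : LocIrrThreeIffCriterion) {d : ℚ} (hd : d ≠ 0)
    (Wd : WeierstrassCurve ℚ) [Wd.IsElliptic] [Wd.IsGloballyMinimal] (C : VariableChange ℚ)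
    (hWd : C • W.quadraticTwist d = Wd) : LocIrr Wd 3 ↔ LocIrr W 3 := by
  rw [h Wd, h W, ← hWd, locIrrCriterionThree_smul_iff, locIrrCriterionThree_quadraticTwist_iff W hd]

/-- Under L-O56-sel, `LocIrr W 3 ⇒ 3 ∣ v₃(Δ_min)` — gen 2's `not_locIrr_three_of_not_three_dvd` without
its target hypothesis `LocIrrThreeTameCube`. [folklore] -/
theorem three_dvd_padicValInt_minimalDiscriminantInt_of_locIrr (h : LocIrrThreeIffCriterion)
    (hL : LocIrr W 3) : (3 : ℤ) ∣ (padicValInt 3 W.minimalDiscriminantInt : ℤ) :=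
  three_dvd_padicValInt_minimalDiscriminantInt_of_locIrrCriterionThree W ((h W).mp hL)

end Corollaries

end Summit.BirchSwinnertonDyer.Rank1Residual.Additive

end
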